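import Literature.MathematicalPhysics.QuantumLattice.FreeFermionColumnToolbox
import HarnessLib

/-!
# A flat column of the square-lattice band crossing a Fermi level, and the cost of climbing it

Topic `MathematicalPhysics/QuantumLattice` (family `hubbard`); proof-only.  Part 2 of the `U = 0`
calibration of the level-count clause (H3) (route `HubbardSuperconductivity/ParityGapRigidity`).

* `exists_flat_column_crossing` — for an even side `L ≥ 16` and a level `-4 < e_F < 0` there is a
  column `a₀` whose bottom `b = ε(a₀, 0)` is the highest column bottom below `e_F` (hence
  `e_F - 4π/L ≤ b < e_F`) and whose crossing index `j*` (first `j` with `ε(a₀, j) > e_F`) obeys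
  `1 ≤ j* ≤ L/2`, `j* - 1 ≤ ⌊√L⌋`: the band is FLAT (`ε(a₀, j) = b + 2(1 - cos(2πj/L))`,
  quadratic in `j`) where the column crosses the Fermi level;
* `column_pair_cost_le` — climbing the column from `j* - 1` to `j* + t`, `t < P ≤ ⌊√L⌋`, costs a
  PAIR at most `24π² ⌊√L⌋ P / L² ≤ c₁/L` once `32π² P ≤ c₁ ⌊√L⌋`.

So a free Fermi sea has `~√L` pair excitations of energy `≤ c/L` above its floor for EVERY `c > 0`,
without any arithmetic input on the position of the Fermi level (the column bottoms are `4π/L`-dense,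
the flat window is `4π²/L` wide).  Everything is proved; no definitions, no named facts. [folklore]
-/

noncomputable section

namespace Literature.MathematicalPhysics.QuantumLattice

open Matrix Finset Literature.Probability.LatticeModels
open scoped ComplexOrder ComplexConjugate

/-! ### Many orthonormal free eigenvectors within `c/L` of the sector floor -/

section LowLying

variable {L : ℕ}

/-- **A flat column crossing the Fermi level.** For an even side `L ≥ 16` and a level
`-4 < e_F < 0` there are a column `a₀ ∈ ℤ/Lℤ` and a crossing index `1 ≤ j* ≤ L/2` with
`j* - 1 ≤ ⌊√L⌋` such that along the column `j ↦ (a₀, j)` the band is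
`ε(a₀, j) = b + 2(1 - cos(2πj/L))` (`j < L`), `ε(a₀, j*) > e_F` and `ε(a₀, j) ≤ e_F` for `j < j*`.
Construction: `a₀` maximises the column bottom `b(a) = -2cos(2πa/L) - 2` among the columns with
`b(a) < e_F` (so `e_F - 4π/L ≤ b`, `exists_cos_step_lt_le`), `j*` is the first index above `e_F`, and
`2(1 - cos(2π(j*-1)/L)) ≤ e_F - b ≤ 4π/L` with `1 - cos v ≥ 2v²/π²` bounds `j* - 1`. [folklore] -/
theorem exists_flat_column_crossing [NeZero L] (hLe : Even L) (hL16 : 16 ≤ L) {eF : ℝ}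
    (heF4 : -4 < eF) (heF0 : eF < 0) :
    ∃ (a₀ : ZMod L) (b : ℝ) (js : ℕ), 1 ≤ js ∧ js ≤ L / 2 ∧ js - 1 ≤ Nat.sqrt L ∧
      (∀ j : ℕ, j < L → torusBand L ![a₀, ((j : ℕ) : ZMod L)] =
        b + 2 * (1 - Real.cos (2 * Real.pi * (j : ℝ) / L))) ∧
      eF < torusBand L ![a₀, ((js : ℕ) : ZMod L)] ∧
      (∀ j : ℕ, j < js → torusBand L ![a₀, ((j : ℕ) : ZMod L)] ≤ eF) := by
  classical
  have hLr : (0 : ℝ) < L := by exact_mod_cast (show 0 < L by omega)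
  have hπ := Real.pi_pos
  -- the column whose bottom is the highest one below `e_F`
  set bf : ZMod L → ℝ := fun a => -2 * Real.cos (2 * Real.pi * (a.val : ℝ) / L) - 2 with hbf
  set A : Finset (ZMod L) := Finset.univ.filter fun a => bf a < eF with hA
  have h0A : (0 : ZMod L) ∈ A := by
    rw [hA, Finset.mem_filter]
    refine ⟨Finset.mem_univ _, ?_⟩
    rw [hbf]; dsimp only; rw [ZMod.val_zero, Nat.cast_zero, mul_zero, zero_div, Real.cos_zero]; linarith
  obtain ⟨a₀, ha₀A, ha₀max⟩ := Finset.exists_max_image A bf ⟨0, h0A⟩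
  have hb₀ : bf a₀ < eF := (Finset.mem_filter.1 ha₀A).2
  have hcosne : Real.cos (2 * Real.pi * (a₀.val : ℝ) / L) ≠ -1 := by
    intro h; rw [hbf] at hb₀; dsimp only at hb₀; rw [h] at hb₀; linarith
  obtain ⟨a', ha'1, ha'2⟩ := exists_cos_step_lt_le hLe a₀ hcosne
  have hb₀low : eF - 4 * Real.pi / L ≤ bf a₀ := by
    have hba' : ¬ bf a' < eF := by
      intro h
      have := ha₀max a' (Finset.mem_filter.2 ⟨Finset.mem_univ _, h⟩)
      rw [hbf] at this; dsimp only at this; linarith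
    push Not at hba'
    rw [hbf] at hba' ⊢; dsimp only at hba' ⊢
    have : (4 : ℝ) * Real.pi / L = 2 * (2 * Real.pi / L) := by ring
    rw [this]; linarith
  -- column energies
  set colE : ℕ → ℝ := fun j => bf a₀ + 2 * (1 - Real.cos (2 * Real.pi * (j : ℝ) / L)) with hcolEdef
  have hcolE : ∀ j : ℕ, j < L → torusBand L ![a₀, ((j : ℕ) : ZMod L)] = colE j := by
    intro j hj
    rw [torusBand_vec2, ZMod.val_natCast, Nat.mod_eq_of_lt hj, hcolEdef, hbf]
    ring
  have hcol0 : colE 0 = bf a₀ := by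
    rw [hcolEdef]; dsimp only; rw [Nat.cast_zero, mul_zero, zero_div, Real.cos_zero]; ring
  have hθle : ∀ j : ℕ, j ≤ L / 2 → 2 * Real.pi * (j : ℝ) / L ≤ Real.pi := by
    intro j hj
    rw [div_le_iff₀ hLr]
    have h2j : (2 * j : ℝ) ≤ L := by exact_mod_cast (show 2 * j ≤ L by omega)
    calc 2 * Real.pi * (j : ℝ) = Real.pi * (2 * j) := by ring
      _ ≤ Real.pi * L := mul_le_mul_of_nonneg_left h2j hπ.le
  have hθnn : ∀ j : ℕ, 0 ≤ 2 * Real.pi * (j : ℝ) / L := fun j => by positivity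
  -- the crossing index
  have hex : ∃ j : ℕ, j ≤ L / 2 ∧ eF < colE j := by
    refine ⟨L / 2, le_rfl, ?_⟩
    rw [hcolEdef]; dsimp only
    have hhalf : 2 * Real.pi * ((L / 2 : ℕ) : ℝ) / L = Real.pi := by
      obtain ⟨m, hm⟩ := hLe
      have hm' : L / 2 = m := by omega
      rw [hm', show (L : ℝ) = 2 * m by exact_mod_cast (by omega : L = 2 * m)]
      have : (m : ℝ) ≠ 0 := by exact_mod_cast (show m ≠ 0 by omega)
      field_simp
    rw [hhalf, Real.cos_pi]
    have : -4 ≤ bf a₀ := by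
      rw [hbf]; dsimp only
      linarith [Real.cos_le_one (2 * Real.pi * (a₀.val : ℝ) / L)]
    linarith
  set js : ℕ := Nat.find hex with hjs
  obtain ⟨hjsL, hjsE⟩ : js ≤ L / 2 ∧ eF < colE js := Nat.find_spec hex
  have hbelow : ∀ j : ℕ, j < js → colE j ≤ eF := by
    intro j hj
    have h := Nat.find_min hex (m := j) (by rw [← hjs]; exact hj)
    push Not at h
    exact h (by omega)
  have hjs1 : 1 ≤ js := by
    by_contra h
    have h0 : js = 0 := by omega
    rw [h0, hcol0] at hjsE
    linarith
  -- `(j* - 1)² ≤ L`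
  have hjs_s : js - 1 ≤ Nat.sqrt L := by
    rw [Nat.le_sqrt']
    have hv := hbelow (js - 1) (by omega)
    rw [hcolEdef] at hv; dsimp only at hv
    set v : ℝ := 2 * Real.pi * ((js - 1 : ℕ) : ℝ) / L with hvdef
    have hJ := mul_sq_le_one_sub_cos (hθnn _) (hθle _ (by omega) : v ≤ Real.pi)
    have h1 : 2 * (2 * v ^ 2 / Real.pi ^ 2) ≤ 4 * Real.pi / L := by linarith
    have h2 : 2 * (2 * v ^ 2 / Real.pi ^ 2) = 16 * ((js - 1 : ℕ) : ℝ) ^ 2 / (L : ℝ) ^ 2 := by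
      rw [hvdef]; field_simp; ring
    rw [h2, div_le_div_iff₀ (by positivity) hLr] at h1
    have h4 : 16 * ((js - 1 : ℕ) : ℝ) ^ 2 ≤ 4 * Real.pi * L := by
      have h1' : (16 * ((js - 1 : ℕ) : ℝ) ^ 2) * L ≤ (4 * Real.pi * L) * L := by
        calc (16 * ((js - 1 : ℕ) : ℝ) ^ 2) * L = 16 * ((js - 1 : ℕ) : ℝ) ^ 2 * L := by ring
          _ ≤ 4 * Real.pi * (L : ℝ) ^ 2 := h1
          _ = (4 * Real.pi * L) * L := by ring
      exact le_of_mul_le_mul_right h1' hLr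
    have h5 : ((js - 1 : ℕ) : ℝ) ^ 2 ≤ L := by
      have hπ4 := Real.pi_lt_four
      have : 4 * Real.pi * (L : ℝ) ≤ 16 * L := by
        have := mul_le_mul_of_nonneg_right (show 4 * Real.pi ≤ 16 by linarith) hLr.le
        linarith
      linarith
    exact_mod_cast h5
  refine ⟨a₀, bf a₀, js, hjs1, hjsL, hjs_s, hcolE, ?_, fun j hj => ?_⟩
  · rw [hcolE js (by omega)]; exact hjsE
  · rw [hcolE j (by omega)]; exact hbelow j hj

/-- **Cost of a column excitation.** The energy difference between the column points `j* + t` and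
`j* - 1` (`t < P ≤ s`, `j* - 1 ≤ s`, `4s ≤ L`, `s² ≤ L`), doubled for a pair, is
`≤ 24π² s P / L² ≤ c₁/L` as soon as `32π² P ≤ c₁ s` (`cos_sub_cos_le_mul`). [folklore] -/
theorem column_pair_cost_le {L s P js t : ℕ} (hL : 0 < L) (hs2 : s ^ 2 ≤ L) (hjs1 : 1 ≤ js)
    (hjs : js - 1 ≤ s) (hPs : P ≤ s) (ht : t < P) (h4s : 4 * s ≤ L) {c₁ : ℝ} (hc₁ : 0 < c₁)
    (hP : (P : ℝ) * (32 * Real.pi ^ 2) ≤ c₁ * s) :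
    2 * (2 * (Real.cos (2 * Real.pi * ((js - 1 : ℕ) : ℝ) / L) -
        Real.cos (2 * Real.pi * ((js + t : ℕ) : ℝ) / L))) ≤ c₁ / L := by
  have hLr : (0 : ℝ) < L := by exact_mod_cast hL
  have hπ := Real.pi_pos
  have hs0 : (0 : ℝ) ≤ s := by positivity
  have hsr : (s : ℝ) ^ 2 ≤ L := by exact_mod_cast hs2
  set u : ℝ := 2 * Real.pi * ((js - 1 : ℕ) : ℝ) / L with hu
  set v : ℝ := 2 * Real.pi * ((js + t : ℕ) : ℝ) / L with hv
  have h2π : (0 : ℝ) ≤ 2 * Real.pi := by positivity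
  have hu0 : 0 ≤ u := by rw [hu]; positivity
  have huv : u ≤ v := by
    rw [hu, hv, div_le_div_iff_of_pos_right hLr]
    have : ((js - 1 : ℕ) : ℝ) ≤ ((js + t : ℕ) : ℝ) := by exact_mod_cast (by omega : js - 1 ≤ js + t)
    exact mul_le_mul_of_nonneg_left this h2π
  have hvπ : v ≤ Real.pi := by
    rw [hv, div_le_iff₀ hLr]
    have h2j : (2 * ((js + t : ℕ) : ℝ)) ≤ L := by exact_mod_cast (show 2 * (js + t) ≤ L by omega)
    calc 2 * Real.pi * ((js + t : ℕ) : ℝ) = Real.pi * (2 * ((js + t : ℕ) : ℝ)) := by ring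
      _ ≤ Real.pi * L := mul_le_mul_of_nonneg_left h2j hπ.le
  have h := cos_sub_cos_le_mul hu0 huv hvπ
  have hsum : u + v ≤ 2 * Real.pi * (3 * s) / L := by
    rw [hu, hv, ← add_div, div_le_div_iff_of_pos_right hLr]
    have h3s : ((js - 1 : ℕ) : ℝ) + ((js + t : ℕ) : ℝ) ≤ 3 * s := by
      have : (js - 1) + (js + t) ≤ 3 * s := by omega
      exact_mod_cast this
    calc 2 * Real.pi * ((js - 1 : ℕ) : ℝ) + 2 * Real.pi * ((js + t : ℕ) : ℝ)
        = 2 * Real.pi * (((js - 1 : ℕ) : ℝ) + ((js + t : ℕ) : ℝ)) := by ring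
      _ ≤ 2 * Real.pi * (3 * s) := mul_le_mul_of_nonneg_left h3s h2π
  have hdif : v - u ≤ 2 * Real.pi * P / L := by
    rw [hu, hv, ← sub_div, div_le_div_iff_of_pos_right hLr]
    have hPt : ((js + t : ℕ) : ℝ) - ((js - 1 : ℕ) : ℝ) ≤ P := by
      have h1 : (js + t) - (js - 1) ≤ P := by omega
      have h2 : js - 1 ≤ js + t := by omega
      rw [← Nat.cast_sub h2]; exact_mod_cast h1
    calc 2 * Real.pi * ((js + t : ℕ) : ℝ) - 2 * Real.pi * ((js - 1 : ℕ) : ℝ)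
        = 2 * Real.pi * (((js + t : ℕ) : ℝ) - ((js - 1 : ℕ) : ℝ)) := by ring
      _ ≤ 2 * Real.pi * P := mul_le_mul_of_nonneg_left hPt h2π
  have h0 : 0 ≤ v - u := by linarith
  have hdiff : 2 * (Real.cos u - Real.cos v) ≤ 12 * Real.pi ^ 2 * s * P / (L : ℝ) ^ 2 :=
    calc 2 * (Real.cos u - Real.cos v) ≤ (u + v) * (v - u) := by linarith
      _ ≤ (2 * Real.pi * (3 * s) / L) * (2 * Real.pi * P / L) :=
          mul_le_mul hsum hdif h0 (by positivity)
      _ = 12 * Real.pi ^ 2 * s * P / (L : ℝ) ^ 2 := by ring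
  have hfinal : 2 * (12 * Real.pi ^ 2 * s * P / (L : ℝ) ^ 2) ≤ c₁ / L := by
    rw [← mul_div_assoc, div_le_div_iff₀ (by positivity) hLr]
    have h34 : (3 / 4 : ℝ) * c₁ ≤ 1 * c₁ := mul_le_mul_of_nonneg_right (by norm_num) hc₁.le
    calc 2 * (12 * Real.pi ^ 2 * (s : ℝ) * P) * L
        = (3 / 4) * ((P : ℝ) * (32 * Real.pi ^ 2)) * (s * L) := by ring
      _ ≤ (3 / 4) * (c₁ * s) * (s * L) :=
          mul_le_mul_of_nonneg_right (mul_le_mul_of_nonneg_left hP (by norm_num))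
            (mul_nonneg hs0 hLr.le)
      _ = (3 / 4) * c₁ * ((s : ℝ) ^ 2 * L) := by ring
      _ ≤ (3 / 4) * c₁ * ((L : ℝ) * L) :=
          mul_le_mul_of_nonneg_left (mul_le_mul_of_nonneg_right hsr hLr.le) (by positivity)
      _ ≤ 1 * c₁ * ((L : ℝ) * L) := mul_le_mul_of_nonneg_right h34 (by positivity)
      _ = c₁ * (L : ℝ) ^ 2 := by ring
  linarith

end LowLying

end Literature.MathematicalPhysics.QuantumLattice

end
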